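import Literature.Algebra.Homology.TraceHomologySequence
import Literature.Algebra.Homology.LefschetzNumberShortExact
import Literature.Algebra.Homology.HomologyEulerCharacteristicShortExact
import HarnessLib

/-!
# `Λ(τ₂) = Λ(τ₁) + Λ(τ₃)` along a short exact sequence of complexes, assuming only finite-dimensional homology (LEAF 2 of 2)

Layer `Literature/Algebra/Homology` (pure linear algebra over Mathlib; proved theorems only, 0 definitions, 0 named facts,
no instances, no notation). For a short exact sequence `S : 0 → X₁ → X₂ → X₃ → 0` of homological complexes of vector spaces
over a field `K` (any shape `c` with `EulerCharSigns`), with an endomorphism `τ : S ⟶ S`, assuming ONLY that the homology of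
`X₁` and of `X₃` is finite-dimensional in each degree with finitely many non-zero degrees (the TERMS may be
infinite-dimensional):

**`lefschetzNumber_X₂_eq_add_of_homology : Λ(τ.τ₂) = Λ(τ.τ₁) + Λ(τ.τ₃)`** for row `LefschetzNumber`'s `lefschetzNumber`.

Proof = the long exact homology sequence with its endomorphism (LEAF 1 `TraceHomologySequence`: every term's trace splits over
the images of the two adjacent maps; here the boundary degrees via Mathlib's `mono_homologyMap_of_mono_of_not_rel` /
`epi_homologyMap_of_epi_of_not_rel` through row `LefschetzNumberShortExact`'s `trace_restrict_range_f_eq` / `trace_restrict_range_g_eq`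
BY NAME) — in the alternating sum the `im Hf` and `im Hg` traces cancel outright and the connecting-map traces `tr(H(τ₁) | im δ)`
cancel in pairs `i ↔ next i` by row `HopfTraceFormula`'s `finsum_χ_smul_eq_neg_of_pairing` BY NAME. This is the TRACE twin of row
`HomologyEulerCharacteristicShortExact` (`τ = 𝟙`, not restated); row `LefschetzNumberShortExact` is the case of finite-dimensional
finitely supported TERMS (proved there through Hopf), not restated here.
Library only (cell `pub-hodge-ring2`, count-neutral); proves nothing about any crux, route or conjecture.

## References

* E. H. Spanier, *Algebraic Topology* (1981), Ch. 4 §7 (traces along exact sequences; Lefschetz number). [Spanier1981]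
* A. Hatcher, *Algebraic Topology* (2002), §2.C. [HatcherAT2002]
-/

open CategoryTheory CategoryTheory.Limits HomologicalComplex

universe v u w

namespace Literature.Algebra.Homology.Lefschetz

variable {K : Type u} [Field K] {ι : Type w} {c : ComplexShape ι}
  {S : ShortComplex (HomologicalComplex (ModuleCat.{v} K) c)} (hS : S.ShortExact) (τ : S ⟶ S)
include hS

/-! ### Boundary degrees -/

/-- With no successor of `i`, `Hᵢ(g)` is onto and `tr(Hᵢ(τ₃) | im Hg) = tr Hᵢ(τ₃)`. [cite: Spanier1981, Ch. 4 §7] -/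
theorem trace_restrict_range_homologyMap_g_eq (i : ι) (hi : ¬c.Rel i (c.next i)) :
    LinearMap.trace K _ ((homologyMap τ.τ₃ i).hom.restrict (HopfTrace.mapsTo_range_homologyMap_g τ i)) =
      LinearMap.trace K _ (homologyMap τ.τ₃ i).hom := by
  haveI := hS.epi_g
  haveI : Epi (homologyMap S.g i) :=
    epi_homologyMap_of_epi_of_not_rel S.g i fun j hj => hi (by rwa [c.next_eq' hj])
  exact trace_restrict_range_g_eq
    (S := ShortComplex.mk (homologyMap S.f i) (homologyMap S.g i) (by rw [← homologyMap_comp, S.zero, homologyMap_zero]))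
    (ShortComplex.homMk (homologyMap τ.τ₁ i) (homologyMap τ.τ₂ i) (homologyMap τ.τ₃ i)
      (HopfTrace.homologyMap_τ₁_comp_f τ i) (HopfTrace.homologyMap_τ₂_comp_g τ i))
    ((ModuleCat.epi_iff_surjective _).1 inferInstance)

/-- With no predecessor of `j`, `Hⱼ(f)` is injective and `tr(Hⱼ(τ₂) | im Hf) = tr Hⱼ(τ₁)`. [cite: Spanier1981, Ch. 4 §7] -/
theorem trace_restrict_range_homologyMap_f_eq (j : ι) (hj : ¬c.Rel (c.prev j) j) :
    LinearMap.trace K _ ((homologyMap τ.τ₂ j).hom.restrict (HopfTrace.mapsTo_range_homologyMap_f τ j)) =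
      LinearMap.trace K _ (homologyMap τ.τ₁ j).hom := by
  haveI := hS.mono_f
  haveI : Mono (homologyMap S.f j) :=
    mono_homologyMap_of_mono_of_not_rel S.f j fun i hi => hj (by rwa [c.prev_eq' hi])
  exact trace_restrict_range_f_eq
    (S := ShortComplex.mk (homologyMap S.f j) (homologyMap S.g j) (by rw [← homologyMap_comp, S.zero, homologyMap_zero]))
    (ShortComplex.homMk (homologyMap τ.τ₁ j) (homologyMap τ.τ₂ j) (homologyMap τ.τ₃ j)
      (HopfTrace.homologyMap_τ₁_comp_f τ j) (HopfTrace.homologyMap_τ₂_comp_g τ j))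
    ((ModuleCat.mono_iff_injective _).1 inferInstance)

omit hS in
/-- The image of a linear map out of a trivial space is a trivial space. [cite: Spanier1981, Ch. 4 §7] -/
theorem subsingleton_range_of_subsingleton {M N : Type*} [AddCommGroup M] [Module K M] [AddCommGroup N] [Module K N]
    [Subsingleton M] (f : M →ₗ[K] N) : Subsingleton (LinearMap.range f) :=
  ⟨fun x y => Subtype.ext (by
    obtain ⟨_, u, rfl⟩ := x
    obtain ⟨_, w, rfl⟩ := y
    rw [Subsingleton.elim u w])⟩

/-! ### The signed sum -/

/-- **Additivity of the Lefschetz number under homology-only finiteness**: along a short exact sequence of complexes with an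
endomorphism `τ`, `Λ(τ₂) = Λ(τ₁) + Λ(τ₃)` as soon as `H(X₁)`, `H(X₃)` are degreewise finite-dimensional with finitely many
non-zero degrees. [cite: Spanier1981, Ch. 4 §7] [cite: HatcherAT2002, §2.C] -/
theorem lefschetzNumber_X₂_eq_add_of_homology [c.EulerCharSigns] [∀ i, Module.Finite K (S.X₁.homology i)]
    [∀ i, Module.Finite K (S.X₃.homology i)] (h₁ : (GradedObject.finrankSupport fun i => S.X₁.homology i).Finite)
    (h₃ : (GradedObject.finrankSupport fun i => S.X₃.homology i).Finite) :
    lefschetzNumber τ.τ₂ = lefschetzNumber τ.τ₁ + lefschetzNumber τ.τ₃ := by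
  classical
  haveI : ∀ i, Module.Finite K (S.X₂.homology i) := fun i => EulerCharShortExact.moduleFinite_homology_X₂ hS i
  have h₂ : (GradedObject.finrankSupport fun i => S.X₂.homology i).Finite :=
    (h₁.union h₃).subset (EulerCharShortExact.finrankSupport_homology_X₂_subset hS)
  -- the connecting-map traces `tr(H(τ₁) | im δ)`, read at the target (`δin`) and at the source (`δout`) of `δ`
  set δin : ι → K := fun j => if h : c.Rel (c.prev j) j then
    LinearMap.trace K _ ((homologyMap τ.τ₁ j).hom.restrict (HopfTrace.mapsTo_range_δ hS τ (c.prev j) j h)) else 0 with hδin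
  set δout : ι → K := fun i => if h : c.Rel i (c.next i) then
    LinearMap.trace K _ ((homologyMap τ.τ₁ (c.next i)).hom.restrict (HopfTrace.mapsTo_range_δ hS τ i (c.next i) h)) else 0
    with hδout
  -- they cancel in pairs `i ↔ next i` (row `HopfTraceFormula`'s pairing lemma)
  have pair := HopfTrace.finsum_χ_smul_eq_neg_of_pairing (c := c) δout δin
    (fun j hj => by simp only [hδin, dif_neg hj]) (fun i hi => by simp only [hδout, dif_neg hi])
    (fun i j hij => by
      have h1 : c.prev j = i := c.prev_eq' hij
      have h2 : c.next i = j := c.next_eq' hij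
      subst h1
      simp only [hδin, hδout]
      rw [h2])
  -- degreewise: `tr H(τ₁) − tr H(τ₂) + tr H(τ₃) = δin + δout` (LEAF 1 + the boundary degrees)
  have key : ∀ i, (c.χ i : ℤ) • LinearMap.trace K _ (homologyMap τ.τ₁ i).hom -
      (c.χ i : ℤ) • LinearMap.trace K _ (homologyMap τ.τ₂ i).hom + (c.χ i : ℤ) • LinearMap.trace K _ (homologyMap τ.τ₃ i).hom =
      (c.χ i : ℤ) • δin i + (c.χ i : ℤ) • δout i := by
    intro i
    have e₁ : LinearMap.trace K _ (homologyMap τ.τ₁ i).hom =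
        LinearMap.trace K _ ((homologyMap τ.τ₂ i).hom.restrict (HopfTrace.mapsTo_range_homologyMap_f τ i)) + δin i := by
      by_cases hp : c.Rel (c.prev i) i
      · simp only [hδin, dif_pos hp]; exact HopfTrace.trace_homologyMap_τ₁_eq_of_rel hS τ _ _ hp
      · simp only [hδin, dif_neg hp, add_zero]; exact (trace_restrict_range_homologyMap_f_eq hS τ i hp).symm
    have e₃ : LinearMap.trace K _ (homologyMap τ.τ₃ i).hom =
        δout i + LinearMap.trace K _ ((homologyMap τ.τ₃ i).hom.restrict (HopfTrace.mapsTo_range_homologyMap_g τ i)) := by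
      by_cases hn : c.Rel i (c.next i)
      · simp only [hδout, dif_pos hn]; exact HopfTrace.trace_homologyMap_τ₃_eq_of_rel hS τ _ _ hn
      · simp only [hδout, dif_neg hn, zero_add]; exact (trace_restrict_range_homologyMap_g_eq hS τ i hn).symm
    rw [e₁, HopfTrace.trace_homologyMap_τ₂_eq hS τ i, e₃, smul_add, smul_add, smul_add]
    abel
  -- finite supports: where a homology space vanishes, so do the traces attached to it
  have s₁ : (fun i => (c.χ i : ℤ) • LinearMap.trace K _ (homologyMap τ.τ₁ i).hom).HasFiniteSupport :=
    h₁.subset (support_χ_smul_trace_homologyMap_subset τ.τ₁)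
  have s₂ : (fun i => (c.χ i : ℤ) • LinearMap.trace K _ (homologyMap τ.τ₂ i).hom).HasFiniteSupport :=
    h₂.subset (support_χ_smul_trace_homologyMap_subset τ.τ₂)
  have s₃ : (fun i => (c.χ i : ℤ) • LinearMap.trace K _ (homologyMap τ.τ₃ i).hom).HasFiniteSupport :=
    h₃.subset (support_χ_smul_trace_homologyMap_subset τ.τ₃)
  have sin : (Function.support fun j => (c.χ j : ℤ) • δin j).Finite := by
    refine h₁.subset fun j hj => ?_
    simp only [GradedObject.finrankSupport, Function.mem_support, ne_eq] at hj ⊢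
    intro h0
    haveI : Subsingleton (S.X₁.homology j) := Module.finrank_zero_iff.1 h0
    have hz : ∀ (p : Submodule K (S.X₁.homology j)) (g : p →ₗ[K] p), LinearMap.trace K p g = 0 := fun p g => by
      rw [Subsingleton.elim g 0, map_zero]
    refine hj ?_
    by_cases h : c.Rel (c.prev j) j
    · simp only [hδin, dif_pos h, hz, smul_zero]
    · simp only [hδin, dif_neg h, smul_zero]
  have sout : (Function.support fun i => (c.χ i : ℤ) • δout i).Finite := by
    refine h₃.subset fun i hi => ?_
    simp only [GradedObject.finrankSupport, Function.mem_support, ne_eq] at hi ⊢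
    intro h0
    haveI : Subsingleton (S.X₃.homology i) := Module.finrank_zero_iff.1 h0
    refine hi ?_
    by_cases h : c.Rel i (c.next i)
    · haveI := subsingleton_range_of_subsingleton (hS.δ i (c.next i) h).hom
      have hz : ∀ g : LinearMap.range (hS.δ i (c.next i) h).hom →ₗ[K] LinearMap.range (hS.δ i (c.next i) h).hom,
          LinearMap.trace K _ g = 0 := fun g => by rw [Subsingleton.elim g 0, map_zero]
      simp only [hδout, dif_pos h, hz, smul_zero]
    · simp only [hδout, dif_neg h, smul_zero]
  have s₁₂ : (fun i => (c.χ i : ℤ) • LinearMap.trace K _ (homologyMap τ.τ₁ i).hom -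
      (c.χ i : ℤ) • LinearMap.trace K _ (homologyMap τ.τ₂ i).hom).HasFiniteSupport := s₁.sub s₂
  have total : lefschetzNumber τ.τ₁ - lefschetzNumber τ.τ₂ + lefschetzNumber τ.τ₃ = 0 := by
    rw [lefschetzNumber, lefschetzNumber, lefschetzNumber, ← finsum_sub_distrib s₁ s₂, ← finsum_add_distrib s₁₂ s₃,
      finsum_congr key, finsum_add_distrib sin sout, pair, neg_add_cancel]
  linear_combination -total

end Literature.Algebra.Homology.Lefschetz
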